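import Literature.Analysis.FluidPDE.ChaeAsymptoticallySelfSimilarEndgame
import Literature.Analysis.FluidPDE.ChaeAsymptoticallySelfSimilarSmallness
import Literature.Analysis.FluidPDE.ClassicalSuitableRegionEnergy
import Literature.Analysis.FluidPDE.ClassicalSolutionGlue
import Literature.Analysis.FluidPDE.RusinSverakBackwardRegularity
import Literature.Analysis.FluidPDE.PressureDecayEstimateProofs
import Literature.Analysis.FluidPDE.CKNInnerCylinders
import HarnessLib

/-!
# Regularity at the top of a cylinder for classical solutions with vanishing cubic functional

Analysis/FluidPDE proofs-layer file (theorems only, no definitions, no named facts), written for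
the discharge of `Literature.Analysis.FluidPDE.chaeWolf2017_dss_typeI_decay`
(`ChaeWolfRemovingDSS.lean`; D. Chae, J. Wolf, *Removing discretely self-similar singularities for
the 3D Navier–Stokes equations*, Comm. PDE 42 (2017) = arXiv:1610.09464, Thm. 1.1). Step 4 of the
printed proof (arXiv p. 7) ends with

> "`lim_{r → 0} r⁻² ∫_{Q(z₀,r)} |u|³ dx dt = 0`. Then thanks to [gus] we infer that `z₀` is a
> regular point"

(`[gus]` = Gustafson–Kang–Tsai, CMP 273 (2007), Thm. 1.1: smallness of
`limsup_{r→0} r⁻² ∫∫_{Q(z₀,r)} |u|³` makes `z₀` regular), applied to a **classical** solution on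
`ℝ³ × (−∞, 0)` at a point `z₀ = (x₀, 0)` of the top boundary of its domain. This file proves that
regularity criterion, in the form needed there, from results PROVED in the tree:

* `exists_cknC_add_cknD_le_of_tendsto_cknC` — **the one-scale smallness from `C(r) → 0`**: for a
  distributional solution on `Q ⊇ Q_{r₀}(z)` (open inclusion: `z` may be a vertex of `Q`) with
  `D(r₀; z) < ∞` and `C(r; z) → 0` as `r → 0⁺`, every `δ > 0` admits a scale `0 < r ≤ r₀` with
  `C(r; z) + D(r; z) ≤ δ`. Proof: the pressure decay estimate
  `D(θr) ≤ c (θ D(r) + θ⁻² C(r))` (`seregin_sverak_pressure_decay_holds`, Seregin–Šverák 2009,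
  (as13)) iterated along `θʲ r₁` (`cknD_iterate_le_of_pressure_decay`): with `cθ ≤ 1/2`,
  `D(θᴶ r₁) ≤ 2^{-J} D(r₁) + 2cθ⁻² sup_{r ≤ r₁} C(r)`.
* `isSuitableWeakSolutionInBall_of_classical'` — a classical solution on the open cylinder
  `Q_r(z)` with the three global classes (`sup_t ∫_{B_r}|v|² ≤ C`, `∇v ∈ L²(Q_r(z))`,
  `q ∈ L^{3/2}(Q_r(z))`) is a suitable weak solution in the parabolic ball `Q_r(z)`
  (Albritton–Barker's class; the unit-cylinder case is the tree's
  `isSuitableWeakSolutionInBall_of_classical`).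
* `exists_bound_near_top_of_classical_of_tendsto_cknC` — **the criterion**: let `(v, π)` be a
  classical solution of Navier–Stokes (`ν = 1`, no force) on `ℝ³ × (0, T)` and `x₀ ∈ ℝ³`; suppose
  that on some cylinder `Q_ρ(T, x₀)`, `ρ² ≤ T`, the velocity `v` together with *some* smooth
  pressure `q` (e.g. `π` minus a smooth function of time) is a classical solution with
  `sup_t ∫_{B_ρ(x₀)} |v(t)|² < ∞`, `∇v ∈ L²(Q_ρ)`, `q ∈ L^{3/2}(Q_ρ)`, and that
  `C(r; (T, x₀)) → 0` as `r → 0⁺`. Then `v` is **bounded** on some cylinder `Q_r(T, x₀)`, `r > 0`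
  (pointwise: `v` is continuous below `T`). Proof: by the first item `C(r) + D(r)` is small at
  some scale `r ≤ ρ`; the pair is in Albritton–Barker's class on `Q_r` (`of_le_radius`), so the
  tree's ε-regularity endgame `chae_exists_eps_holder_of_suitableInBall` (ESS 2003, Lemma 2.2 via
  Robinson–Rodrigo–Sadowski's Thm. 15.3, all proved) makes `v` Hölder continuous, hence bounded,
  on a smaller cylinder with the same vertex.
* `exists_bound_near_top_of_classical_Iio` — the same for a classical solution on
  `ℝ³ × (−∞, 0)` at a point `(0, x₀)` (time translation), the form used for Chae–Wolf's theorem.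

## References

* S. Gustafson, K. Kang, T.-P. Tsai, *Interior regularity criteria for suitable weak solutions of
  the Navier–Stokes equations*, Comm. Math. Phys. 273 (2007) 161–176, Thm. 1.1.
  [GustafsonKangTsai2007]
* D. Chae, J. Wolf, arXiv:1610.09464, proof of Thm. 1.3/1.1, Step 4 (p. 7). [ChaeWolf2017RemovingDSS]
* G. Seregin, V. Šverák, Comm. PDE 34 (2009) = arXiv:0804.1803, proof of Lemma 3.5, (as13).
  [SereginSverak2009]
* L. Escauriaza, G. Seregin, V. Šverák, Russ. Math. Surveys 58 (2003), Lemma 2.2.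
  [EscauriazaSereginSverak2003]
-/

noncomputable section

open MeasureTheory Set Function Filter Metric TopologicalSpace Bornology
open _root_.Topology
open scoped NNReal ENNReal

namespace Literature.Analysis.FluidPDE

/-! ### One-scale smallness from `C(r) → 0` -/

section Smallness

variable {Q : Opens (ℝ × EuclideanSpace ℝ (Fin 3))}
  {u : ℝ → EuclideanSpace ℝ (Fin 3) → EuclideanSpace ℝ (Fin 3)}
  {p : ℝ → EuclideanSpace ℝ (Fin 3) → ℝ}

/-- In `ℝ≥0∞`: for `K ≠ ∞` and every `b`, the number `e = b / (K + 1)` satisfies `K e ≤ b`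
and `e ≤ b`. [folklore] -/
private theorem mul_div_add_one_le_aux (K b : ℝ≥0∞) (hK : K ≠ ∞) :
    K * (b / (K + 1)) ≤ b ∧ b / (K + 1) ≤ b := by
  have h1 : K + 1 ≠ 0 := by simp
  have h1' : K + 1 ≠ ∞ := by simpa using hK
  constructor
  · calc K * (b / (K + 1)) ≤ (K + 1) * (b / (K + 1)) := by gcongr; exact le_self_add
      _ = b := ENNReal.mul_div_cancel h1 h1'
  · calc b / (K + 1) ≤ b / 1 := by gcongr; exact le_add_self
      _ = b := by rw [div_one]

/-- **One-scale smallness of `C + D` from `C(r) → 0`.** Let `(u, p)` be a distributional solution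
of Navier–Stokes (`ν = 1`, no force) on an open `Q ⊇ Q_{r₀}(z)` (the vertex `z` may lie on
`∂Q`), with `D(r₀; z) < ∞` and `C(r; z) → 0` as `r → 0⁺`. Then for every `δ > 0` there is a scale
`0 < r ≤ r₀` with `C(r; z) + D(r; z) ≤ δ`: the pressure decay estimate of Seregin–Šverák,
iterated along the scales `θʲ r₁` with `cθ ≤ 1/2`, gives `D(θᴶ r₁) ≤ 2^{-J} D(r₁) + 2cθ⁻² e` as
soon as `C ≤ e` on `]0, r₁]`. (The quantitative content of "`lim_{r→0} r⁻² ∫_{Q(z₀,r)} |u|³ = 0`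
⇒ `z₀` regular", Chae–Wolf 2017, end of Step 4, via [gus].) [cite: SereginSverak2009, proof of Lemma 3.5, (as13) and its iteration (arXiv:0804.1803 p. 10)] -/
theorem exists_cknC_add_cknD_le_of_tendsto_cknC (hdist : IsDistributionalNSSolutionOn Q 1 0 u p)
    {z : ℝ × EuclideanSpace ℝ (Fin 3)} {r₀ : ℝ} (hr₀ : 0 < r₀)
    (hsub : parabolicCylinder r₀ z ⊆ (Q : Set (ℝ × EuclideanSpace ℝ (Fin 3))))
    (hD : cknD r₀ z p ≠ ∞) (hC : Tendsto (fun r => cknC r z u) (𝓝[>] 0) (𝓝 0))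
    {δ : ℝ≥0∞} (hδ : 0 < δ) :
    ∃ r ∈ Ioc 0 r₀, cknC r z u + cknD r z p ≤ δ := by
  -- the constant of the decay estimate and the ratio `θ`
  obtain ⟨c, hc⟩ := seregin_sverak_pressure_decay_holds.ratio
  obtain ⟨θ, hθ, hθ2, hcθ⟩ := exists_ratio_mul_le_half c
  have hθ1 : θ ≤ 1 := hθ2.trans (by norm_num)
  -- the level `e` of the cubic functional
  set K : ℝ≥0∞ := 2 * ((c : ℝ≥0∞) * ENNReal.ofReal ((θ⁻¹) ^ 2)) with hK
  have hKtop : K ≠ ∞ := ENNReal.mul_ne_top (by norm_num)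
    (ENNReal.mul_ne_top ENNReal.coe_ne_top ENNReal.ofReal_ne_top)
  set b : ℝ≥0∞ := δ / 4 with hb
  have hb0 : b ≠ 0 := (ENNReal.div_pos hδ.ne' (by norm_num)).ne'
  set e : ℝ≥0∞ := b / (K + 1) with he
  obtain ⟨hKe, heb⟩ := mul_div_add_one_le_aux K b hKtop
  have he0 : 0 < e := ENNReal.div_pos hb0 (by simpa using hKtop)
  -- `C ≤ e` on a whole interval of scales `]0, r₁]`, `r₁ ≤ r₀`
  obtain ⟨r₁, hr₁, hr₁r₀, hCe⟩ : ∃ r₁ : ℝ, 0 < r₁ ∧ r₁ ≤ r₀ ∧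
      ∀ r ∈ Ioc (0 : ℝ) r₁, cknC r z u ≤ e := by
    have hev : ∀ᶠ r in 𝓝[>] (0 : ℝ), cknC r z u < e := hC (gt_mem_nhds he0)
    rw [(nhdsGT_basis (0 : ℝ)).eventually_iff] at hev
    obtain ⟨ε, hε, h⟩ := hev
    refine ⟨min (ε / 2) r₀, lt_min (half_pos hε) hr₀, min_le_right _ _, fun r hr => (h ?_).le⟩
    exact ⟨hr.1, lt_of_le_of_lt (hr.2.trans (min_le_left _ _)) (half_lt_self hε)⟩
  have hsub₁ : parabolicCylinder r₁ z ⊆ (Q : Set (ℝ × EuclideanSpace ℝ (Fin 3))) :=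
    (parabolicCylinder_mono hr₁.le hr₁r₀ z).trans hsub
  -- `D(r₁) < ∞`
  have hD₁ : cknD r₁ z p ≠ ∞ :=
    ne_top_of_le_ne_top (ENNReal.mul_ne_top (ENNReal.pow_ne_top ENNReal.ofReal_ne_top) hD)
      (cknD_le_mul_of_subset hr₀ hr₁ (parabolicCylinder_mono hr₁.le hr₁r₀ z) p)
  -- the number of steps `J`
  obtain ⟨J, hJ⟩ := exists_inv_two_pow_mul_le hD₁ (pos_iff_ne_zero.2 hb0)
  -- the scale
  have hθJ : 0 < θ ^ J := pow_pos hθ J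
  have hθJ1 : θ ^ J ≤ 1 := pow_le_one₀ hθ.le hθ1
  refine ⟨θ ^ J * r₁, ⟨mul_pos hθJ hr₁, (mul_le_of_le_one_left hr₁.le hθJ1).trans hr₁r₀⟩, ?_⟩
  have hiter := cknD_iterate_le_of_pressure_decay hc hθ hθ1 hcθ hdist hr₁ hsub₁ (e := e) (J := J)
    (fun j _ => hCe _ ⟨mul_pos (pow_pos hθ j) hr₁,
      mul_le_of_le_one_left hr₁.le (pow_le_one₀ hθ.le hθ1)⟩)
  have hCJ : cknC (θ ^ J * r₁) z u ≤ e :=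
    hCe _ ⟨mul_pos hθJ hr₁, mul_le_of_le_one_left hr₁.le hθJ1⟩
  calc cknC (θ ^ J * r₁) z u + cknD (θ ^ J * r₁) z p
      ≤ e + ((2⁻¹ : ℝ≥0∞) ^ J * cknD r₁ z p + K * e) := by
        refine add_le_add hCJ (hiter.trans_eq ?_)
        rw [hK]; ring
    _ ≤ b + (b + b) := add_le_add heb (add_le_add hJ hKe)
    _ = δ / 4 + δ / 4 + δ / 4 := by rw [hb]; ring
    _ ≤ δ := ENNReal.add_quarters_le δ

end Smallness

/-! ### Classical solutions in a cylinder are in Albritton–Barker's class -/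

section InBall

variable {v : ℝ → EuclideanSpace ℝ (Fin 3) → EuclideanSpace ℝ (Fin 3)}
  {q : ℝ → EuclideanSpace ℝ (Fin 3) → ℝ}

/-- **Classical solutions in an open cylinder with the three global classes are suitable weak
solutions in the parabolic ball** `Q_r(z)` (`IsSuitableWeakSolutionInBall r z`, Albritton–Barker
2019, Def. 2.1): the interior conditions hold for every classical solution
(`IsClassicalNSSolutionOnRegion.isSuitableWeakSolutionOn`), the weak gradient is the classical
one, and the global classes `sup_t ∫_{B_r}|v|² ≤ C`, `∫∫ |∇v|² < ∞`, `q ∈ L^{3/2}` are the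
hypotheses (general-cylinder form of the tree's `isSuitableWeakSolutionInBall_of_classical`). [cite: AlbrittonBarker2019, Def. 2.1] -/
theorem isSuitableWeakSolutionInBall_of_classical' {r : ℝ} {z : ℝ × EuclideanSpace ℝ (Fin 3)}
    (hv : IsClassicalNSSolutionOnRegion (parabolicCylinder r z) 1 0 v q)
    {C : ℝ≥0} (hC : ∀ t ∈ Ioo (z.1 - r ^ 2) z.1,
      ∫⁻ x in ball z.2 r, ‖v t x‖ₑ ^ 2 ≤ C)
    (hG : ∫⁻ w in parabolicCylinder r z,
      ENNReal.ofReal (frobeniusNormSq (fderiv ℝ (v w.1) w.2)) < ⊤)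
    (hq : MemLp (uncurry q) (3 / 2) (volume.restrict (parabolicCylinder r z))) :
    IsSuitableWeakSolutionInBall r z v q := by
  refine ⟨?_, ⟨C, ?_⟩, ⟨fun t x => fderiv ℝ (v t) x, ?_, hG⟩, hq⟩
  · exact hv.isSuitableWeakSolutionOn (isOpen_parabolicCylinder r z) one_pos
  · exact (ae_restrict_iff' measurableSet_Ioo).2 (ae_of_all _ fun t ht => hC t ht)
  · exact hv.hasWeakSpatialGradientOn (isOpen_parabolicCylinder r z) subset_rfl

/-- `D(r; z) < ∞` for a pressure in `L^{3/2}(Q_r(z))`, `r > 0`. [folklore] -/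
theorem cknD_ne_top_of_memLp {r : ℝ} (hr : 0 < r) {z : ℝ × EuclideanSpace ℝ (Fin 3)}
    (hq : MemLp (uncurry q) (3 / 2) (volume.restrict (parabolicCylinder r z))) :
    cknD r z q ≠ ∞ := by
  have h32 : ((3 / 2 : ℝ≥0∞)).toReal = (3 / 2 : ℝ) := by
    rw [ENNReal.toReal_div]; norm_num
  have h0 : (3 / 2 : ℝ≥0∞) ≠ 0 := by norm_num
  have htop : (3 / 2 : ℝ≥0∞) ≠ ∞ := ENNReal.div_ne_top (by norm_num) (by norm_num)
  have hlt := lintegral_rpow_enorm_lt_top_of_eLpNorm_lt_top h0 htop hq.eLpNorm_lt_top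
  rw [h32] at hlt
  refine ENNReal.mul_ne_top (ENNReal.inv_ne_top.2 (pow_ne_zero _ ?_)) ?_
  · exact (ENNReal.ofReal_pos.2 hr).ne'
  · exact (lt_of_le_of_lt (le_of_eq rfl) hlt).ne

end InBall

/-! ### Hölder continuity on a cylinder gives a bound -/

section HolderBound

variable {X F : Type*} [PseudoMetricSpace X] [SeminormedAddCommGroup F]

/-- A function which is Hölder continuous on a bounded set is bounded there. [folklore] -/
theorem exists_norm_le_of_holderOnWith {C α : ℝ≥0} {f : X → F} {s : Set X}
    (hf : HolderOnWith C α f s) (hs : IsBounded s) : ∃ M : ℝ, ∀ x ∈ s, ‖f x‖ ≤ M := by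
  have himg : IsBounded (f '' s) := by
    rw [Metric.isBounded_iff_ediam_ne_top] at hs ⊢
    refine ne_top_of_le_ne_top ?_ hf.ediam_image_le
    exact ENNReal.mul_ne_top ENNReal.coe_ne_top
      (ENNReal.rpow_ne_top_of_nonneg (by positivity) hs)
  obtain ⟨M, hM⟩ := himg.exists_norm_le
  exact ⟨M, fun x hx => hM _ (mem_image_of_mem f hx)⟩

/-- Parabolic cylinders of `ℝ × X` are bounded. [folklore] -/
theorem isBounded_parabolicCylinder (r : ℝ) (z : ℝ × X) : IsBounded (parabolicCylinder r z) :=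
  (isBounded_Ioo _ _).prod isBounded_ball

end HolderBound

/-! ### The criterion -/

section Criterion

variable {T : ℝ} {v : ℝ → EuclideanSpace ℝ (Fin 3) → EuclideanSpace ℝ (Fin 3)}
  {π q : ℝ → EuclideanSpace ℝ (Fin 3) → ℝ}

/-- **Regularity at a top boundary point from `C(r) → 0` (Gustafson–Kang–Tsai's criterion, the
case used by Chae–Wolf), for classical solutions.** Let `(v, π)` be a classical solution of the
unforced Navier–Stokes system (`ν = 1`) on `ℝ³ × (0, T)`, `x₀ ∈ ℝ³`, `0 < ρ`, `ρ² ≤ T`, and let `q`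
be a smooth pressure for `v` on the cylinder `Q_ρ(T, x₀) = (T − ρ², T) × B(x₀, ρ)` (a classical
solution `(v, q)` on that open region — typically `q = π − m(t)` for a smooth `m`) such that
`sup_{T−ρ²<t<T} ∫_{B(x₀,ρ)} |v(t)|² < ∞`, `∇v ∈ L²(Q_ρ(T, x₀))`, `q ∈ L^{3/2}(Q_ρ(T, x₀))`, and
`C(r; (T, x₀)) = r⁻² ∫∫_{Q_r(T,x₀)} |v|³ → 0` as `r → 0⁺`. Then `v` is bounded on some cylinder
`Q_r(T, x₀)`, `r > 0` ("`lim_{r→0} r⁻² ∫_{Q(z₀,r)} |u|³ = 0`. Then thanks to [gus] we infer that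
`z₀` is a regular point", Chae–Wolf 2017, Step 4; here: smallness of `C + D` at one scale by the
pressure decay iteration, then the ε-regularity lemma up to the top,
`chae_exists_eps_holder_of_suitableInBall`). [cite: GustafsonKangTsai2007, Thm. 1.1; ChaeWolf2017RemovingDSS, proof of Thm. 1.1, Step 4 (arXiv p. 7)] -/
theorem exists_bound_near_top_of_classical_of_tendsto_cknC
    (hv : IsClassicalNSSolutionOn (Ioo 0 T) 1 0 v π) (x₀ : EuclideanSpace ℝ (Fin 3))
    {ρ : ℝ} (hρ : 0 < ρ) (hρT : ρ ^ 2 ≤ T)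
    (hvq : IsClassicalNSSolutionOnRegion (parabolicCylinder ρ (T, x₀)) 1 0 v q)
    {C : ℝ≥0} (hC : ∀ t ∈ Ioo (T - ρ ^ 2) T, ∫⁻ x in ball x₀ ρ, ‖v t x‖ₑ ^ 2 ≤ C)
    (hG : ∫⁻ w in parabolicCylinder ρ (T, x₀),
      ENNReal.ofReal (frobeniusNormSq (fderiv ℝ (v w.1) w.2)) < ⊤)
    (hq : MemLp (uncurry q) (3 / 2) (volume.restrict (parabolicCylinder ρ (T, x₀))))
    (hlim : Tendsto (fun r => cknC r (T, x₀) v) (𝓝[>] 0) (𝓝 0)) :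
    ∃ r > 0, ∃ M : ℝ, ∀ w ∈ parabolicCylinder r (T, x₀), ‖v w.1 w.2‖ ≤ M := by
  obtain ⟨ε₀, hε₀, H⟩ := chae_exists_eps_holder_of_suitableInBall hv x₀
  have hball : IsSuitableWeakSolutionInBall ρ (T, x₀) v q :=
    isSuitableWeakSolutionInBall_of_classical' hvq hC hG hq
  have hdist : IsDistributionalNSSolutionOn (parabolicCylinderOpens ρ (T, x₀)) 1 0 v q :=
    hball.1.distributional
  have hD : cknD ρ (T, x₀) q ≠ ∞ := cknD_ne_top_of_memLp hρ hq
  -- smallness of `C + D` at some scale `r ≤ ρ`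
  have hδ : (0 : ℝ≥0∞) < ENNReal.ofReal ε₀ / 2 :=
    ENNReal.div_pos (ENNReal.ofReal_pos.2 hε₀).ne' (by norm_num)
  obtain ⟨r, ⟨hr, hrρ⟩, hsmall⟩ := exists_cknC_add_cknD_le_of_tendsto_cknC hdist hρ
    (by simp only [coe_parabolicCylinderOpens]; exact subset_rfl) hD hlim hδ
  have hlt : cknC r (T, x₀) v + cknD r (T, x₀) q < ENNReal.ofReal ε₀ :=
    hsmall.trans_lt (ENNReal.half_lt_self (ENNReal.ofReal_pos.2 hε₀).ne' ENNReal.ofReal_ne_top)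
  have hballr : IsSuitableWeakSolutionInBall r (T, x₀) v q := hball.of_le_radius hr hrρ
  have hrT : r ^ 2 ≤ T := (pow_le_pow_left₀ hr.le hrρ 2).trans hρT
  obtain ⟨r', hr', C', α, hα, hH⟩ := H r hr hrT v q hballr Filter.EventuallyEq.rfl hlt
  obtain ⟨M, hM⟩ := exists_norm_le_of_holderOnWith hH (isBounded_parabolicCylinder r' (T, x₀))
  exact ⟨r', hr', M, fun w hw => hM w hw⟩

variable {u : ℝ → EuclideanSpace ℝ (Fin 3) → EuclideanSpace ℝ (Fin 3)}
  {p : ℝ → EuclideanSpace ℝ (Fin 3) → ℝ}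

/-- **The same at a point `(0, x₀)` of the top of `ℝ³ × (−∞, 0)`** (the setting of Chae–Wolf
2017, Thm. 1.1): for a classical solution `(u, p)` of the unforced system (`ν = 1`) on
`ℝ³ × (−∞, 0)` and a smooth pressure `q` for `u` on `Q_ρ(0, x₀)` with
`sup_{−ρ²<t<0} ∫_{B(x₀,ρ)} |u(t)|² < ∞`, `∇u ∈ L²(Q_ρ(0, x₀))`, `q ∈ L^{3/2}(Q_ρ(0, x₀))` and
`C(r; (0, x₀)) → 0`, the velocity is bounded on some `Q_r(0, x₀)`, `r > 0` (time translation
`t ↦ t − ρ²` to the previous statement). [cite: ChaeWolf2017RemovingDSS, proof of Thm. 1.1, Step 4 (arXiv p. 7); GustafsonKangTsai2007 Thm. 1.1] -/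
theorem exists_bound_near_top_of_classical_Iio
    (hu : IsClassicalNSSolutionOn (Iio 0) 1 0 u p) (x₀ : EuclideanSpace ℝ (Fin 3))
    {ρ : ℝ} (hρ : 0 < ρ)
    (huq : IsClassicalNSSolutionOnRegion (parabolicCylinder ρ (0, x₀)) 1 0 u q)
    {C : ℝ≥0} (hC : ∀ t ∈ Ioo (-ρ ^ 2) 0, ∫⁻ x in ball x₀ ρ, ‖u t x‖ₑ ^ 2 ≤ C)
    (hG : ∫⁻ w in parabolicCylinder ρ (0, x₀),
      ENNReal.ofReal (frobeniusNormSq (fderiv ℝ (u w.1) w.2)) < ⊤)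
    (hq : MemLp (uncurry q) (3 / 2) (volume.restrict (parabolicCylinder ρ (0, x₀))))
    (hlim : Tendsto (fun r => cknC r (0, x₀) u) (𝓝[>] 0) (𝓝 0)) :
    ∃ r > 0, ∃ M : ℝ, ∀ w ∈ parabolicCylinder r (0, x₀), ‖u w.1 w.2‖ ≤ M := by
  -- time translation by `T = ρ²`
  set T : ℝ := ρ ^ 2 with hT
  have hT0 : 0 < T := by positivity
  set v : ℝ → EuclideanSpace ℝ (Fin 3) → EuclideanSpace ℝ (Fin 3) := fun t => u (t + -T) with hv
  set π' : ℝ → EuclideanSpace ℝ (Fin 3) → ℝ := fun t => p (t + -T) with hπ'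
  set q' : ℝ → EuclideanSpace ℝ (Fin 3) → ℝ := fun t => q (t + -T) with hq'
  have hvsol : IsClassicalNSSolutionOn (Ioo 0 T) 1 0 v π' := by
    have h1 := hu.comp_add_right (-T)
    have hsub : Ioo 0 T ⊆ (· + -T) ⁻¹' Iio (0 : ℝ) := fun t ht => by
      simp only [mem_preimage, mem_Iio]; linarith [ht.2]
    exact h1.mono hsub (uniqueDiffOn_Ioo 0 T)
  -- the translation as a space–time affine map
  have hpre : ∀ r : ℝ, (fun w : ℝ × EuclideanSpace ℝ (Fin 3) => (w.1 + -T, w.2)) ⁻¹'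
      parabolicCylinder r (0, x₀) = parabolicCylinder r (T, x₀) := by
    intro r; ext w
    simp only [mem_preimage, mem_parabolicCylinder]
    constructor
    · rintro ⟨⟨h1, h2⟩, h3⟩; exact ⟨⟨by linarith, by linarith⟩, h3⟩
    · rintro ⟨⟨h1, h2⟩, h3⟩; exact ⟨⟨by linarith, by linarith⟩, h3⟩
  have hmp : MeasurePreserving (fun w : ℝ × EuclideanSpace ℝ (Fin 3) => (w.1 + -T, w.2))
      volume volume := by
    have := (measurePreserving_add_right (volume : Measure ℝ) (-T)).prod
      (MeasurePreserving.id (volume : Measure (EuclideanSpace ℝ (Fin 3))))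
    exact this
  have hme : MeasurableEmbedding (fun w : ℝ × EuclideanSpace ℝ (Fin 3) => (w.1 + -T, w.2)) :=
    ((Homeomorph.addRight (-T)).prodCongr (Homeomorph.refl _)).measurableEmbedding
  -- the region predicate translates
  have hvq : IsClassicalNSSolutionOnRegion (parabolicCylinder ρ (T, x₀)) 1 0 v q' := by
    have key := (isClassicalNSSolutionOnRegion_iff_of_isOpen (isOpen_parabolicCylinder ρ _)).1 huq
    obtain ⟨hsm_u, hsm_q, hmom, hdiv⟩ := key
    rw [isClassicalNSSolutionOnRegion_iff_of_isOpen (isOpen_parabolicCylinder ρ _)]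
    have haff : ContDiff ℝ (⊤ : ℕ∞) (fun w : ℝ × EuclideanSpace ℝ (Fin 3) => (w.1 + -T, w.2)) :=
      (contDiff_fst.add contDiff_const).prodMk contDiff_snd
    have hmaps : MapsTo (fun w : ℝ × EuclideanSpace ℝ (Fin 3) => (w.1 + -T, w.2))
        (parabolicCylinder ρ (T, x₀)) (parabolicCylinder ρ (0, x₀)) := by
      intro w hw; rw [← hpre ρ] at hw; exact hw
    refine ⟨?_, ?_, fun t x htx => ?_, fun t x htx => ?_⟩
    · exact hsm_u.comp haff.contDiffOn hmaps
    · exact hsm_q.comp haff.contDiffOn hmaps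
    · have h1 := hmom (t + -T) x (hmaps htx)
      have e1 : deriv (fun s => v s x) t = deriv (fun s => u s x) (t + -T) := by
        simp only [hv]
        exact deriv_comp_add_const (fun s => u s x) (-T) t
      rw [e1]; exact h1
    · exact hdiv (t + -T) x (hmaps htx)
  -- the three classes translate
  have hC' : ∀ t ∈ Ioo (T - ρ ^ 2) T, ∫⁻ x in ball x₀ ρ, ‖v t x‖ₑ ^ 2 ≤ C := by
    intro t ht
    exact hC (t + -T) ⟨by linarith [ht.1], by linarith [ht.2]⟩
  have hG' : ∫⁻ w in parabolicCylinder ρ (T, x₀),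
      ENNReal.ofReal (frobeniusNormSq (fderiv ℝ (v w.1) w.2)) < ⊤ := by
    have e := hmp.setLIntegral_comp_preimage_emb hme
      (fun w : ℝ × EuclideanSpace ℝ (Fin 3) => ENNReal.ofReal (frobeniusNormSq (fderiv ℝ (u w.1) w.2)))
      (parabolicCylinder ρ (0, x₀))
    rw [hpre ρ] at e
    simpa [hv] using e.trans_lt hG
  have hq'' : MemLp (uncurry q') (3 / 2) (volume.restrict (parabolicCylinder ρ (T, x₀))) := by
    have e : uncurry q' = uncurry q ∘ (fun w : ℝ × EuclideanSpace ℝ (Fin 3) => (w.1 + -T, w.2)) := by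
      funext w; rfl
    rw [e, ← hpre ρ]
    exact hq.comp_measurePreserving (hmp.restrict_preimage_emb hme _)
  have hlim' : Tendsto (fun r => cknC r (T, x₀) v) (𝓝[>] 0) (𝓝 0) := by
    have e : ∀ r, cknC r (T, x₀) v = cknC r (0, x₀) u := by
      intro r
      simp only [cknC]
      congr 1
      have := hmp.setLIntegral_comp_preimage_emb hme
        (fun w : ℝ × EuclideanSpace ℝ (Fin 3) => ‖u w.1 w.2‖ₑ ^ (3 : ℕ)) (parabolicCylinder r (0, x₀))
      rw [hpre r] at this
      simpa [hv] using this
    simp_rw [e]; exact hlim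
  obtain ⟨r, hr, M, hM⟩ := exists_bound_near_top_of_classical_of_tendsto_cknC hvsol x₀ hρ le_rfl
    hvq hC' hG' hq'' hlim'
  refine ⟨r, hr, M, fun w hw => ?_⟩
  have hw' : (w.1 + T, w.2) ∈ parabolicCylinder r (T, x₀) := by
    rw [mem_parabolicCylinder] at hw ⊢
    obtain ⟨⟨h1, h2⟩, h3⟩ := hw
    exact ⟨⟨by simp only at h1 ⊢; linarith, by simp only at h2 ⊢; linarith⟩, h3⟩
  have := hM _ hw'
  simpa [hv] using this

end Criterion

end Literature.Analysis.FluidPDE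

end
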